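import Summits.ResolutionOfSingularities.ResolutionOfSingularities.Theorems.MarkedTransferCampaignW13RFlatCanonicalPosSurfaceLowArc
import HarnessLib

/-!
# [OURS · L1 W1.3] Surfaces, every characteristic — the low-order family `g′_p = u^p + x^{p(p²−p+1)} + L·(L^p − x^{p²+1})^{p−1}`
# (part 2/2): canonical datum, ORDER `p² − p + 1`, and the failure of `RFlatTailPow` for every prime `p` (seat res-L1-s13-pv-1, g3)

LADDER-RESOLUTION rung L (rescue), cell `res-hironaka`, RESCUE-SEED slot W1.3 (architecture bypass, reading R-flat), F7′ row 1.
Part 1 (`…SurfaceLowArc.lean`, `W13.surfLow_tail_pow_not_mem`): `u^p ∉ ℘_alg(((g′_p),p),1)`. This part: (i) the EULER CERTIFICATE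
`ε′_p = x·∂ₓA′_p + y·∂_yB′_p` with `B′_p = y·F′^{p−1}` (`∂_yF′ = 0`) and `A′_p = −Σ_{i=0}^{p−2} x^{(p²+1)i+1}(y^p−x^p)^{p−1−i}/(i+1)`
(char-`p` geometric identity `F′^{p−1} = Σ_{i<p} x^{(p²+1)i}(y^p−x^p)^{p−1−i}`, using `(−1)^{p−1} = 1` in characteristic `p`; its
last term times `−x` is `−x^{p(p²−p+1)}`) — so `ε′_p` is `p`-power-free and the datum (`e = 1`, tail `u`, `r = 0`) is CANONICAL
(`surfLow_isCanonicalChain`); (ii) the ORDERS `ε′_p ∈ 𝔪^{p²−p+1} ∖ 𝔪^{p²−p+2}` and, for comparison, `ε_p ∈ 𝔪^{p²−1} ∖ 𝔪^{p²}` for the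
first family of p515380 (`surfLow_ord_mem/_not_mem`, `surfAllP_ord_mem/_not_mem`; non-memberships by the substitution `x, u ↦ 0`,
`y ↦ t`, p517081 `X_pow_dvd_of_mem_pow_idealOfVars`); (iii) `¬ RFlatTailPow` on the datum and the packaged statement
**`exists_canonical_rFlat_failure_of_order`: for every prime `p` and every field `K` of characteristic `p` there is a CANONICAL chain
datum on a SURFACE head in `K[x,y,u]` whose knock-out has order EXACTLY `p(p−1)+1` and whose tail fails `RFlatTailPow`** — the
order-`p²−p+1` sharpening of p515380 (`= 3, 7, 21` for `p = 2, 3, 5`). Computed evidence on minimality, NOT a theorem: kit j274638 /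
j274681 / j274816 / j274817 (tag res, linear arc-solver over `𝔽₃`, 4598 arcs, degree ≤ 24) found 84 `p = 3` witnesses of order 7
and NONE of order ≤ 6. Caveat of record: nothing here bears on L-G4 / (127) (`KangarooShadeIncrease`).

HONEST FRAMING. OURS statements about the OURS bypass objects (bound algebraic `℘`, row 003 U17_2); nothing here is a statement of
H. Hironaka's manuscript [Hironaka2017] (2017-03-23, lit key `paper:url-3343fd9e678b`); no claim about resolution of singularities in
positive characteristic; AI bookkeeping weaker than expert review. All decls `[folklore]`, sorry-free.
-/

noncomputable section

set_option linter.dupNamespace false -- mandated namespace of this single-conjunct summit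

namespace Summit.ResolutionOfSingularities.ResolutionOfSingularities.Theorems.Campaign

open MvPolynomial
open Literature.AlgebraicGeometry.Resolution
open Literature.AlgebraicGeometry.Hironaka2017
open Literature.AlgebraicGeometry.Hironaka2017.S09LLUED (LLChainData)

namespace W13

/-! ## §1 The Euler certificate for `ε′_p` -/

section CanonicalLow

variable (K : Type) [Field K] (k : ℕ) [hp : Fact (k + 2).Prime] [CharP K (k + 2)]

omit hp [CharP K (k + 2)] in
/-- `F′ = (y−x)^p − x^{p²+1} ≠ 0` (substitute `x ↦ 0, y ↦ 1`). [folklore] -/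
theorem surfLow_F_ne_zero :
    (((X 1 : MvPolynomial (Fin 3) K) - X 0) ^ (k + 2) - X 0 ^ (k ^ 2 + 4 * k + 4 + 1)) ≠ 0 := by
  intro h
  have h1 := congrArg (MvPolynomial.aeval (![0, 1, 0] : Fin 3 → K)) h
  simp only [map_sub, map_pow, MvPolynomial.aeval_X, Matrix.cons_val_one, Matrix.cons_val_zero,
    sub_zero, one_pow, map_zero, zero_pow (Nat.succ_ne_zero _)] at h1
  exact one_ne_zero h1

/-- In characteristic `p = k+2`: `(−1)^{p−1} = 1` (from `(−1)^p = −1`). [folklore] -/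
theorem neg_one_pow_char_sub_one' : ((-1 : MvPolynomial (Fin 3) K)) ^ (k + 1) = 1 := by
  have h := neg_one_pow_char (MvPolynomial (Fin 3) K) (k + 2)
  rw [pow_succ] at h
  have h2 : ((-1 : MvPolynomial (Fin 3) K)) ^ (k + 1) * (-1) = 1 * (-1) := by rw [h, one_mul]
  exact mul_right_cancel₀ (neg_ne_zero.mpr one_ne_zero) h2

/-- Characteristic-`p` geometric identity: `Σ_{i<p} (x^{p²+1})^i·(y^p−x^p)^{p−1−i} = F′^{p−1}` (`F′ = (y−x)^p − x^{p²+1}`; multiply by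
`x^{p²+1} − (y^p−x^p) = −F′`, freshman's dream, `(−1)^{p−1} = 1`, cancel `F′ ≠ 0`). [folklore] -/
theorem surfLow_geom_sum :
    ∑ i ∈ Finset.range (k + 2), ((X 0 : MvPolynomial (Fin 3) K) ^ (k ^ 2 + 4 * k + 4 + 1)) ^ i *
        (X 1 ^ (k + 2) - X 0 ^ (k + 2)) ^ (k + 2 - 1 - i) =
      ((X 1 - X 0) ^ (k + 2) - X 0 ^ (k ^ 2 + 4 * k + 4 + 1)) ^ (k + 1) := by
  have h := geom_sum₂_mul ((X 0 : MvPolynomial (Fin 3) K) ^ (k ^ 2 + 4 * k + 4 + 1)) (X 1 ^ (k + 2) - X 0 ^ (k + 2)) (k + 2)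
  rw [← sub_pow_char ((X 0 : MvPolynomial (Fin 3) K) ^ (k ^ 2 + 4 * k + 4 + 1)) (X 1 ^ (k + 2) - X 0 ^ (k + 2)),
    pow_succ ((X 0 : MvPolynomial (Fin 3) K) ^ (k ^ 2 + 4 * k + 4 + 1) - (X 1 ^ (k + 2) - X 0 ^ (k + 2))) (k + 1)] at h
  have hc : (X 1 : MvPolynomial (Fin 3) K) ^ (k + 2) - X 0 ^ (k + 2) = (X 1 - X 0) ^ (k + 2) :=
    (sub_pow_char (X 1 : MvPolynomial (Fin 3) K) (X 0)).symm
  have hne : ((X 0 : MvPolynomial (Fin 3) K) ^ (k ^ 2 + 4 * k + 4 + 1) - (X 1 ^ (k + 2) - X 0 ^ (k + 2))) ≠ 0 := by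
    rw [hc, Ne, sub_eq_zero]
    intro e
    exact surfLow_F_ne_zero K k (by rw [← e, sub_self])
  have hS := mul_right_cancel₀ hne h
  rw [hS, hc, show (X 0 : MvPolynomial (Fin 3) K) ^ (k ^ 2 + 4 * k + 4 + 1) - (X 1 - X 0) ^ (k + 2) =
    (-1) * ((X 1 - X 0) ^ (k + 2) - X 0 ^ (k ^ 2 + 4 * k + 4 + 1)) by ring, mul_pow, neg_one_pow_char_sub_one' K k, one_mul]

omit hp in
/-- The exponents `(p²+1)i + 1 ≡ i + 1 (mod p)`. [folklore] -/
theorem surfLow_cast_exp (i : ℕ) : ((((k ^ 2 + 4 * k + 4 + 1) * i + 1 : ℕ) : K)) = ((i + 1 : ℕ) : K) := by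
  have h : ((k + 2 : ℕ) : K) = 0 := CharP.cast_eq_zero K (k + 2)
  push_cast at h ⊢
  linear_combination ((k : K) + 2) * (i : K) * h

/-- **The Euler certificate for the low-order family**: `ε′_p = x·∂ₓA′_p + y·∂_yB′_p` with
`A′_p = −Σ_{i<p−1} x^{(p²+1)i+1}(y^p−x^p)^{p−1−i}/(i+1)` and `B′_p = y·F′^{p−1}`. [folklore] -/
theorem surfLow_euler :
    ((X 0 ^ ((k ^ 2 + 3 * k + 3) * (k + 2)) +
        (X 1 - X 0) * ((X 1 - X 0) ^ (k + 2) - X 0 ^ (k ^ 2 + 4 * k + 4 + 1)) ^ (k + 1)) : MvPolynomial (Fin 3) K) =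
      X 0 * pderiv 0 (-(∑ i ∈ Finset.range (k + 1), C (((i + 1 : ℕ) : K)⁻¹) *
          (X 0 ^ ((k ^ 2 + 4 * k + 4 + 1) * i + 1) * (X 1 ^ (k + 2) - X 0 ^ (k + 2)) ^ (k + 1 - i)))) +
        X 1 * pderiv 1 (X 1 * ((X 1 - X 0) ^ (k + 2) - X 0 ^ (k ^ 2 + 4 * k + 4 + 1)) ^ (k + 1)) := by
  have hc : ((k + 2 : ℕ) : MvPolynomial (Fin 3) K) = 0 := CharP.cast_eq_zero _ (k + 2)
  -- the `y`-part
  have hF1 : pderiv 1 (((X 1 : MvPolynomial (Fin 3) K) - X 0) ^ (k + 2) - X 0 ^ (k ^ 2 + 4 * k + 4 + 1)) = 0 := by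
    rw [map_sub, pderiv_pow, hc, zero_mul, zero_mul, zero_sub, pderiv_pow,
      pderiv_X_of_ne (show (0 : Fin 3) ≠ 1 by decide), mul_zero, neg_zero]
  have hB : (X 1 : MvPolynomial (Fin 3) K) *
      pderiv 1 (X 1 * ((X 1 - X 0) ^ (k + 2) - X 0 ^ (k ^ 2 + 4 * k + 4 + 1)) ^ (k + 1)) =
        X 1 * ((X 1 - X 0) ^ (k + 2) - X 0 ^ (k ^ 2 + 4 * k + 4 + 1)) ^ (k + 1) := by
    rw [pderiv_mul, pderiv_pow, hF1, mul_zero, mul_zero, add_zero, pderiv_X_self, one_mul]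
  -- the `x`-part
  have hA : (X 0 : MvPolynomial (Fin 3) K) * pderiv 0 (-(∑ i ∈ Finset.range (k + 1), C (((i + 1 : ℕ) : K)⁻¹) *
      (X 0 ^ ((k ^ 2 + 4 * k + 4 + 1) * i + 1) * (X 1 ^ (k + 2) - X 0 ^ (k + 2)) ^ (k + 1 - i)))) =
      -(∑ i ∈ Finset.range (k + 1),
        (X 0 : MvPolynomial (Fin 3) K) ^ ((k ^ 2 + 4 * k + 4 + 1) * i + 1) * (X 1 ^ (k + 2) - X 0 ^ (k + 2)) ^ (k + 1 - i)) := by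
    rw [map_neg, mul_neg, map_sum, Finset.mul_sum]
    congr 1
    refine Finset.sum_congr rfl fun i hi => ?_
    have hi' : ((i + 1 : ℕ) : K) ≠ 0 := by
      rw [Ne, CharP.cast_eq_zero_iff K (k + 2)]
      exact Nat.not_dvd_of_pos_of_lt (Nat.succ_pos i) (by have := Finset.mem_range.mp hi; omega)
    rw [surfAllP_x_pderiv_term K k _ _ (Nat.succ_pos _), surfLow_cast_exp K k, inv_mul_cancel₀ hi', map_one, one_mul]
  have hsumX : (X 0 : MvPolynomial (Fin 3) K) * ((X 1 - X 0) ^ (k + 2) - X 0 ^ (k ^ 2 + 4 * k + 4 + 1)) ^ (k + 1) =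
      ∑ i ∈ Finset.range (k + 1),
          (X 0 : MvPolynomial (Fin 3) K) ^ ((k ^ 2 + 4 * k + 4 + 1) * i + 1) * (X 1 ^ (k + 2) - X 0 ^ (k + 2)) ^ (k + 1 - i) +
        X 0 ^ ((k ^ 2 + 3 * k + 3) * (k + 2)) := by
    rw [← surfLow_geom_sum K k, Finset.mul_sum, Finset.sum_range_succ]
    congr 1
    · refine Finset.sum_congr rfl fun i _ => ?_
      rw [← pow_mul, show k + 2 - 1 - i = k + 1 - i by omega]
      ring
    · rw [← pow_mul, show k + 2 - 1 - (k + 1) = 0 by omega, pow_zero, mul_one, ← pow_succ']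
      congr 1
      ring
  rw [hA, hB]
  linear_combination (-1 : MvPolynomial (Fin 3) K) * hsumX

/-- **The datum is CANONICAL for every `p`** (low-order family): `ε′_p` is free of `u` and `p`-power-free (Euler certificate
`surfLow_euler` + p512821 `exists_not_dvd_of_eq_euler`). [folklore] -/
theorem surfLow_isCanonicalChain (d : LLChainData (MvPolynomial (Fin 3) K))
    (hdg : d.g 0 = X 2 ^ (k + 2) + (X 0 ^ ((k ^ 2 + 3 * k + 3) * (k + 2)) +
      (X 1 - X 0) * ((X 1 - X 0) ^ (k + 2) - X 0 ^ (k ^ 2 + 4 * k + 4 + 1)) ^ (k + 1)))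
    (hde : d.e = 1) (hdt : d.tail = X 2) :
    IsCanonicalChain (k + 2) K (2 : Fin 3) d := by
  classical
  have hx : ∀ i : Fin 3, i ≠ 2 → (X i : MvPolynomial (Fin 3) K) ∈ supported K ({2}ᶜ : Set (Fin 3)) :=
    fun i hi => (X_mem_supported (R := K)).mpr hi
  have h0 := hx 0 (by decide)
  have h1 := hx 1 (by decide)
  refine ⟨X 0 ^ ((k ^ 2 + 3 * k + 3) * (k + 2)) +
      (X 1 - X 0) * ((X 1 - X 0) ^ (k + 2) - X 0 ^ (k ^ 2 + 4 * k + 4 + 1)) ^ (k + 1), 0, ?_, by simp, ?_,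
    by rw [hdt, add_zero], ?_⟩
  · exact not_mem_vars_of_mem_supported (add_mem (pow_mem h0 _)
      (mul_mem (sub_mem h1 h0) (pow_mem (sub_mem (pow_mem (sub_mem h1 h0) _) (pow_mem h0 _)) _)))
  · rw [hdg, hde, pow_one]
  · rw [hde, pow_one, zero_pow hp.out.ne_zero, sub_zero]
    exact exists_not_dvd_of_eq_euler (k + 2) (0 : Fin 3) 1 _ _ (surfLow_euler K k)

/-- **`¬ RFlatTailPow p`** (v4 schema) for the canonical datum on `g′_p`. [folklore] -/
theorem surfLow_not_rFlatTailPow (d : LLChainData (MvPolynomial (Fin 3) K))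
    (hdg : d.g 0 = X 2 ^ (k + 2) + (X 0 ^ ((k ^ 2 + 3 * k + 3) * (k + 2)) +
      (X 1 - X 0) * ((X 1 - X 0) ^ (k + 2) - X 0 ^ (k ^ 2 + 4 * k + 4 + 1)) ^ (k + 1)))
    (hde : d.e = 1) (hdt : d.tail = X 2) :
    ¬ Campaign.RFlatTailPow (k + 2) K (Ideal.span {d.g 0}) ((k + 2) ^ d.e) d := by
  rw [Campaign.RFlatTailPow, hdg, hde, hdt, pow_one]
  exact surfLow_tail_pow_not_mem K k

end CanonicalLow

/-! ## §2 The orders: `ε′_p ∈ 𝔪^{p²−p+1} ∖ 𝔪^{p²−p+2}`, `ε_p ∈ 𝔪^{p²−1} ∖ 𝔪^{p²}` -/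

section Orders

variable (K : Type) [Field K] (k : ℕ)

/-- `ord₀ ε′_p ≥ p² − p + 1 = k² + 3k + 3`. [folklore] -/
theorem surfLow_ord_mem :
    ((X 0 ^ ((k ^ 2 + 3 * k + 3) * (k + 2)) +
        (X 1 - X 0) * ((X 1 - X 0) ^ (k + 2) - X 0 ^ (k ^ 2 + 4 * k + 4 + 1)) ^ (k + 1)) : MvPolynomial (Fin 3) K) ∈
      idealOfVars (Fin 3) K ^ (k ^ 2 + 3 * k + 3) := by
  classical
  have hX : ∀ i : Fin 3, (X i : MvPolynomial (Fin 3) K) ∈ idealOfVars (Fin 3) K :=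
    fun i => Ideal.subset_span (Set.mem_range_self i)
  have hL : (X 1 - X 0 : MvPolynomial (Fin 3) K) ∈ idealOfVars (Fin 3) K := Ideal.sub_mem _ (hX 1) (hX 0)
  refine Ideal.add_mem _ ?_ ?_
  · exact Ideal.pow_le_pow_right (show k ^ 2 + 3 * k + 3 ≤ (k ^ 2 + 3 * k + 3) * (k + 2) by nlinarith)
      (Ideal.pow_mem_pow (hX 0) _)
  · have hF : (((X 1 : MvPolynomial (Fin 3) K) - X 0) ^ (k + 2) - X 0 ^ (k ^ 2 + 4 * k + 4 + 1)) ∈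
        idealOfVars (Fin 3) K ^ (k + 2) :=
      Ideal.sub_mem _ (Ideal.pow_mem_pow hL _)
        (Ideal.pow_le_pow_right (show k + 2 ≤ k ^ 2 + 4 * k + 4 + 1 by nlinarith) (Ideal.pow_mem_pow (hX 0) _))
    have h := Ideal.mul_mem_mul hL (Ideal.pow_mem_pow hF (k + 1))
    rw [← pow_mul, ← pow_succ'] at h
    rwa [show k ^ 2 + 3 * k + 3 = (k + 2) * (k + 1) + 1 by ring]

/-- `ord₀ ε′_p < p² − p + 2`: substitute `x, u ↦ 0`, `y ↦ t` (`ε′_p ↦ t^{p²−p+1}`). [folklore] -/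
theorem surfLow_ord_not_mem :
    ((X 0 ^ ((k ^ 2 + 3 * k + 3) * (k + 2)) +
        (X 1 - X 0) * ((X 1 - X 0) ^ (k + 2) - X 0 ^ (k ^ 2 + 4 * k + 4 + 1)) ^ (k + 1)) : MvPolynomial (Fin 3) K) ∉
      idealOfVars (Fin 3) K ^ (k ^ 2 + 3 * k + 3 + 1) := by
  classical
  intro h
  have hφ : ∀ i, Polynomial.X ∣ (MvPolynomial.aeval ![(0 : Polynomial K), Polynomial.X, 0]) (X i : MvPolynomial (Fin 3) K) := by
    intro i
    fin_cases i
    · exact ⟨0, by simp⟩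
    · exact ⟨1, by simp⟩
    · exact ⟨0, by simp⟩
  have hd := X_pow_dvd_of_mem_pow_idealOfVars K _ hφ _ h
  have he : (MvPolynomial.aeval ![(0 : Polynomial K), Polynomial.X, 0])
      ((X 0 ^ ((k ^ 2 + 3 * k + 3) * (k + 2)) +
        (X 1 - X 0) * ((X 1 - X 0) ^ (k + 2) - X 0 ^ (k ^ 2 + 4 * k + 4 + 1)) ^ (k + 1)) : MvPolynomial (Fin 3) K) =
      Polynomial.X ^ (k ^ 2 + 3 * k + 3) := by
    simp only [map_add, map_sub, map_mul, map_pow, MvPolynomial.aeval_X, Matrix.cons_val_zero, Matrix.cons_val_one,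
      sub_zero, zero_pow (Nat.succ_ne_zero _), zero_pow (show (k ^ 2 + 3 * k + 3) * (k + 2) ≠ 0 by positivity), zero_add]
    rw [← pow_mul, ← pow_succ']
    congr 1
    ring
  rw [he, Polynomial.X_pow_dvd_iff] at hd
  have := hd (k ^ 2 + 3 * k + 3) (Nat.lt_succ_self _)
  rw [Polynomial.coeff_X_pow, if_pos rfl] at this
  exact one_ne_zero this

/-- `ord₀ ε_p ≥ p² − 1 = k² + 4k + 3` (the first family, p515380). [folklore] -/
theorem surfAllP_ord_mem :
    (((X 0 ^ 3 * (X 1 - X 0) ^ k) ^ (k + 2) +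
        (X 1 - X 0) ^ (k + 1) * ((X 1 - X 0) ^ (k + 2) + X 0 ^ (2 * k + 5)) ^ (k + 1)) : MvPolynomial (Fin 3) K) ∈
      idealOfVars (Fin 3) K ^ (k ^ 2 + 4 * k + 3) := by
  classical
  have hX : ∀ i : Fin 3, (X i : MvPolynomial (Fin 3) K) ∈ idealOfVars (Fin 3) K :=
    fun i => Ideal.subset_span (Set.mem_range_self i)
  have hL : (X 1 - X 0 : MvPolynomial (Fin 3) K) ∈ idealOfVars (Fin 3) K := Ideal.sub_mem _ (hX 1) (hX 0)
  refine Ideal.add_mem _ ?_ ?_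
  · have hM : ((X 0 : MvPolynomial (Fin 3) K) ^ 3 * (X 1 - X 0) ^ k) ∈ idealOfVars (Fin 3) K ^ (3 + k) := by
      rw [pow_add]
      exact Ideal.mul_mem_mul (Ideal.pow_mem_pow (hX 0) 3) (Ideal.pow_mem_pow hL k)
    have h := Ideal.pow_mem_pow hM (k + 2)
    rw [← pow_mul] at h
    exact Ideal.pow_le_pow_right (show k ^ 2 + 4 * k + 3 ≤ (3 + k) * (k + 2) by nlinarith) h
  · have hF : (((X 1 : MvPolynomial (Fin 3) K) - X 0) ^ (k + 2) + X 0 ^ (2 * k + 5)) ∈ idealOfVars (Fin 3) K ^ (k + 2) :=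
      Ideal.add_mem _ (Ideal.pow_mem_pow hL _)
        (Ideal.pow_le_pow_right (show k + 2 ≤ 2 * k + 5 by omega) (Ideal.pow_mem_pow (hX 0) _))
    have h := Ideal.mul_mem_mul (Ideal.pow_mem_pow hL (k + 1)) (Ideal.pow_mem_pow hF (k + 1))
    rw [← pow_mul, ← pow_add] at h
    rwa [show k ^ 2 + 4 * k + 3 = k + 1 + (k + 2) * (k + 1) by ring]

/-- `ord₀ ε_p < p²` (the first family): `x, u ↦ 0`, `y ↦ t` sends `ε_p` to `t^{p²−1}`. [folklore] -/
theorem surfAllP_ord_not_mem :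
    (((X 0 ^ 3 * (X 1 - X 0) ^ k) ^ (k + 2) +
        (X 1 - X 0) ^ (k + 1) * ((X 1 - X 0) ^ (k + 2) + X 0 ^ (2 * k + 5)) ^ (k + 1)) : MvPolynomial (Fin 3) K) ∉
      idealOfVars (Fin 3) K ^ (k ^ 2 + 4 * k + 3 + 1) := by
  classical
  intro h
  have hφ : ∀ i, Polynomial.X ∣ (MvPolynomial.aeval ![(0 : Polynomial K), Polynomial.X, 0]) (X i : MvPolynomial (Fin 3) K) := by
    intro i
    fin_cases i
    · exact ⟨0, by simp⟩
    · exact ⟨1, by simp⟩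
    · exact ⟨0, by simp⟩
  have hd := X_pow_dvd_of_mem_pow_idealOfVars K _ hφ _ h
  have he : (MvPolynomial.aeval ![(0 : Polynomial K), Polynomial.X, 0])
      (((X 0 ^ 3 * (X 1 - X 0) ^ k) ^ (k + 2) +
        (X 1 - X 0) ^ (k + 1) * ((X 1 - X 0) ^ (k + 2) + X 0 ^ (2 * k + 5)) ^ (k + 1)) : MvPolynomial (Fin 3) K) =
      Polynomial.X ^ (k ^ 2 + 4 * k + 3) := by
    simp only [map_add, map_sub, map_mul, map_pow, MvPolynomial.aeval_X, Matrix.cons_val_zero, Matrix.cons_val_one,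
      sub_zero, zero_pow (Nat.succ_ne_zero _), zero_mul, add_zero, zero_add]
    rw [← pow_mul, ← pow_add]
    congr 1
    ring
  rw [he, Polynomial.X_pow_dvd_iff] at hd
  have := hd (k ^ 2 + 4 * k + 3) (Nat.lt_succ_self _)
  rw [Polynomial.coeff_X_pow, if_pos rfl] at this
  exact one_ne_zero this

end Orders

end W13

/-! ## §3 Packaged: a canonical R-flat failure of order EXACTLY `p(p−1)+1` on a surface, every characteristic -/

section HeadlineLow

/-- **For every prime `p` and every field `K` of characteristic `p` there is a CANONICAL chain datum on a SURFACE head in `K[x,y,u]`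
(chart `Fin 3`, tail variable `2`, level `e = 1`) whose knock-out `g(0) − u^p` has order EXACTLY `p(p−1)+1` and whose tail FAILS
`RFlatTailPow`** — witness `g′_p = u^p + x^{p(p²−p+1)} + (y−x)((y−x)^p − x^{p²+1})^{p−1}` (`W13.surfLow_*`). The order-`p²−p+1`
sharpening of `not_CampaignW13RFlatCanonicalPos_fin3_allChar` (p515380, order `p²−1`). [folklore] -/
theorem exists_canonical_rFlat_failure_of_order (K : Type) [Field K] (p : ℕ) [hp : Fact p.Prime] [CharP K p] :
    ∃ d : LLChainData (MvPolynomial (Fin 3) K), IsCanonicalChain p K (2 : Fin 3) d ∧ d.e = 1 ∧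
      ¬ Campaign.RFlatTailPow p K (Ideal.span {d.g 0}) (p ^ d.e) d ∧
      d.g 0 - X 2 ^ p ∈ idealOfVars (Fin 3) K ^ (p * (p - 1) + 1) ∧
      d.g 0 - X 2 ^ p ∉ idealOfVars (Fin 3) K ^ (p * (p - 1) + 2) := by
  obtain ⟨k, rfl⟩ : ∃ k, p = k + 2 := ⟨p - 2, (Nat.sub_add_cancel hp.out.two_le).symm⟩
  have e1 : (k + 2) * (k + 2 - 1) + 1 = k ^ 2 + 3 * k + 3 := by
    rw [show k + 2 - 1 = k + 1 by omega]; ring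
  have e2 : (k + 2) * (k + 2 - 1) + 2 = k ^ 2 + 3 * k + 3 + 1 := by
    rw [show k + 2 - 1 = k + 1 by omega]; ring
  refine ⟨⟨1, fun _ => X 2,
      fun j => if j = 0 then X 2 ^ (k + 2) + (X 0 ^ ((k ^ 2 + 3 * k + 3) * (k + 2)) +
        (X 1 - X 0) * ((X 1 - X 0) ^ (k + 2) - X 0 ^ (k ^ 2 + 4 * k + 4 + 1)) ^ (k + 1)) else X 2,
      fun _ => X 0 ^ ((k ^ 2 + 3 * k + 3) * (k + 2)) +
        (X 1 - X 0) * ((X 1 - X 0) ^ (k + 2) - X 0 ^ (k ^ 2 + 4 * k + 4 + 1)) ^ (k + 1),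
      fun _ => 0, fun _ => (k ^ 2 + 3 * k + 3 : ℕ)⟩, ?_, rfl, ?_, ?_, ?_⟩
  · exact W13.surfLow_isCanonicalChain K k _ (by simp) rfl (by simp [LLChainData.tail])
  · exact W13.surfLow_not_rFlatTailPow K k _ (by simp) rfl (by simp [LLChainData.tail])
  · rw [e1]
    simp only [if_pos, add_sub_cancel_left]
    exact W13.surfLow_ord_mem K k
  · rw [e2]
    simp only [if_pos, add_sub_cancel_left]
    exact W13.surfLow_ord_not_mem K k

end HeadlineLow

end Summit.ResolutionOfSingularities.ResolutionOfSingularities.Theorems.Campaign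

end
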